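import Summits.HubbardSuperconductivity.HubbardSuperconductivity.Theorems.NodalDiracTwistBridgeNodalToDWaveDiracIntraBlock
import Summits.HubbardSuperconductivity.HubbardSuperconductivity.Theorems.NodalDiracTwistBridgeNodalToDWaveMomentumGlobal

/-!
# Route `NodalDiracTwist`, crux `BridgeNodalToDWave` (stmt-HubbardSuperconductivity-10395) —
# helper: the Dirac points of the nodal-Dirac package are crossings inside the momentum block

Line `birth`, lead c11 (`--supports stmt-HubbardSuperconductivity-10395`); the momentum-block
instance of `exists_orthogonal_pair_in_block` (`…DiracIntraBlock`), combining clause (I) (unique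
sector ground state off the diagonal quartet `(±c, ±c)`), clause (II) (holonomy `−1` around a
quartet point `p`, radius `r < min(c, π − c)`) and the global momentum constancy
`clauseI_translation_sign_eq_untwisted` (`…MomentumGlobal`): **the `(N, S^z = 0)` sector ground
space of `H_L(U,p)` at a Dirac point `p` contains an orthogonal pair of joint eigenvectors of the
unit translations `U_{e₁}`, `U_{e₂}` with the SAME eigenvalues `(s₀, s₁)` as the untwisted sector
ground state** (`dirac_pair_in_momentum_block`, registered sub-goal `stub_diracPairInMomentumBlock`).
In words (lead c9's audit item S3, second half, kernel-checked): the conical crossings of the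
package happen inside the momentum block `K₀ ∈ {0, (π,π)}` of the bulk ground state — they are not
contacts with a foreign momentum sector.

Sources: Y. Hatsugai, J. Phys. Soc. Jpn. 75 (2006) 123601; T. Fukui, Y. Hatsugai, H. Suzuki,
J. Phys. Soc. Jpn. 74 (2005) 1674.  No new definitions, no named facts.
-/

-- the mandated namespace `Summit.<Summit>.<Problem>.Theorems` repeats `HubbardSuperconductivity`
set_option linter.dupNamespace false

noncomputable section

namespace Summit.HubbardSuperconductivity.HubbardSuperconductivity.Theorems.NodalDiracTwist.BridgeNodalToDWave

open Matrix Filter Topology Literature.MathematicalPhysics.QuantumLattice Literature.Probability.LatticeModels HubbardWave0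
open Summit.HubbardSuperconductivity.HubbardSuperconductivity.Theorems.NodalDiracTwist
open scoped ComplexOrder

variable (L : ℕ) [NeZero L]

/-- Twists of a small disk about a quartet point stay in the open cell and meet the quartet only at
the centre: if `|p 0| = |p 1| = c`, `0 < c`, `r < c`, `r < π - c` and `|φ - p| ≤ r`, then `|φ i| < π`,
and `|φ 0| = |φ 1| = c` forces `φ = p`. [folklore] -/
theorem disk_about_quartet_point {c : ℝ} (hc0 : 0 < c) {p : Fin 2 → ℝ} (hp0 : |p 0| = c)
    (hp1 : |p 1| = c) {r : ℝ} (hr : 0 ≤ r) (hrc : r < c) (hrπ : r < Real.pi - c) {φ : Fin 2 → ℝ}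
    (hφ : (φ 0 - p 0) ^ 2 + (φ 1 - p 1) ^ 2 ≤ r ^ 2) :
    |φ 0| < Real.pi ∧ |φ 1| < Real.pi ∧ (φ ≠ p → ¬ (|φ 0| = c ∧ |φ 1| = c)) := by
  obtain ⟨h0, h1⟩ := abs_le_of_sq_add_sq_le hr hφ
  refine ⟨?_, ?_, fun hne hcc => hne ?_⟩
  · calc |φ 0| = |(φ 0 - p 0) + p 0| := by rw [sub_add_cancel]
      _ ≤ |φ 0 - p 0| + |p 0| := abs_add_le _ _
      _ < Real.pi := by rw [hp0]; linarith
  · calc |φ 1| = |(φ 1 - p 1) + p 1| := by rw [sub_add_cancel]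
      _ ≤ |φ 1 - p 1| + |p 1| := abs_add_le _ _
      _ < Real.pi := by rw [hp1]; linarith
  · have key : ∀ i : Fin 2, |φ i| = c → |p i| = c → |φ i - p i| ≤ r → φ i = p i := by
      intro i hφi hpi hd
      rcases abs_eq_abs.1 (hφi.trans hpi.symm) with h | h
      · exact h
      · exfalso
        rw [h, show -p i - p i = -(2 * p i) by ring, abs_neg, abs_mul, abs_two, hpi] at hd
        linarith
    funext i
    fin_cases i
    · exact key 0 hcc.1 hp0 h0
    · exact key 1 hcc.2 hp1 h1

/-- **The Dirac points of the package are crossings inside the momentum block.**  Assume clause (I)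
with `0 < c < π`, a quartet point `p` (`|p 0| = |p 1| = c`), a radius `0 < r < min(c, π - c)` with the
holonomy clause (II) at `(p, r)`, and an untwisted sector ground state `χ₀` with
`U_{e₁} χ₀ = s₀ χ₀`, `U_{e₂} χ₀ = s₁ χ₀`.  Then the sector ground space at `p` contains an
orthogonal pair `χ₁ ⊥ χ₂` with `U_{e₁} χ_j = s₀ χ_j`, `U_{e₂} χ_j = s₁ χ_j`. Hatsugai (2006);
Fukui–Hatsugai–Suzuki (2005). [folklore] -/
theorem dirac_pair_in_momentum_block {U : ℝ} {N : ℕ} {c : ℝ}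
    (hI : ∀ φ : Fin 2 → ℝ, φ 0 ∈ Set.Ioc (-Real.pi) Real.pi → φ 1 ∈ Set.Ioc (-Real.pi) Real.pi →
      ((∃ ψ₁ ψ₂ : Fock (Orb (FermionTorus 2 L)),
        IsGroundStateInSector (spinTwistedHubbardTorus L U φ) N 0 ψ₁ ∧
        IsGroundStateInSector (spinTwistedHubbardTorus L U φ) N 0 ψ₂ ∧ star ψ₁ ⬝ᵥ ψ₂ = 0) ↔
        (|φ 0| = c ∧ |φ 1| = c)))
    (hc0 : 0 < c) (hcπ : c < Real.pi) {p : Fin 2 → ℝ} (hp0 : |p 0| = c) (hp1 : |p 1| = c)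
    {r : ℝ} (hr : 0 < r) (hrc : r < c) (hrπ : r < Real.pi - c)
    (hHOL : ∃ n₀ : ℕ, ∀ n ≥ n₀, ∀ ψ : Fin n → Fock (Orb (FermionTorus 2 L)),
      (∀ i : Fin n, IsGroundStateInSector (spinTwistedHubbardTorus L U (fun ν : Fin 2 => p ν + r *
        (if ν = 0 then Real.cos (2 * Real.pi * (i : ℕ) / n)
          else Real.sin (2 * Real.pi * (i : ℕ) / n)))) N 0 (ψ i) ∧ star (ψ i) ⬝ᵥ ψ i = 1) →
      (∏ i : Fin n, star (ψ i) ⬝ᵥ ψ (finRotate n i)).re < 0)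
    {χ₀ : Fock (Orb (FermionTorus 2 L))} (hχ₀ : IsGroundStateInSector (spinTwistedHubbardTorus L U 0) N 0 χ₀)
    {s₀ s₁ : ℂ} (hs₀ : (fockTranslate (Pi.single 0 1 : TorusSite 2 L)).val *ᵥ χ₀ = s₀ • χ₀)
    (hs₁ : (fockTranslate (Pi.single 1 1 : TorusSite 2 L)).val *ᵥ χ₀ = s₁ • χ₀) :
    ∃ χ₁ χ₂ : Fock (Orb (FermionTorus 2 L)),
      IsGroundStateInSector (spinTwistedHubbardTorus L U p) N 0 χ₁ ∧
      IsGroundStateInSector (spinTwistedHubbardTorus L U p) N 0 χ₂ ∧ star χ₁ ⬝ᵥ χ₂ = 0 ∧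
      (fockTranslate (Pi.single 0 1 : TorusSite 2 L)).val *ᵥ χ₁ = s₀ • χ₁ ∧
      (fockTranslate (Pi.single 1 1 : TorusSite 2 L)).val *ᵥ χ₁ = s₁ • χ₁ ∧
      (fockTranslate (Pi.single 0 1 : TorusSite 2 L)).val *ᵥ χ₂ = s₀ • χ₂ ∧
      (fockTranslate (Pi.single 1 1 : TorusSite 2 L)).val *ᵥ χ₂ = s₁ • χ₂ := by
  classical
  -- the untwisted ground state is unique, so `s₀, s₁ = ±1` (in particular real)
  have h0cell : (0 : Fin 2 → ℝ) 0 ∈ Set.Ioc (-Real.pi) Real.pi :=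
    ⟨by simpa using Real.pi_pos, by simpa using Real.pi_pos.le⟩
  have huniq0 : ∀ χ', IsGroundStateInSector (spinTwistedHubbardTorus L U 0) N 0 χ' → ∃ z : ℂ, χ' = z • χ₀ := by
    refine unique_of_no_orthogonal_pair (fun hpair => ?_) χ₀
      |> fun h χ' h' => h χ' hχ₀ h'
    have h := (hI 0 h0cell h0cell).1 hpair
    simp only [Pi.zero_apply, abs_zero] at h
    exact absurd h.1 (ne_of_lt hc0)
  have hsreal : ∀ {v : TorusSite 2 L} {s : ℂ}, (fockTranslate v).val *ᵥ χ₀ = s • χ₀ → star s = s := by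
    intro v s hs
    have hpm : s = 1 ∨ s = -1 := by
      rcases fockTranslate_mulVec_eq_self_or_eq_neg L hχ₀ huniq0 v with h | h
      · left
        have h2 : (s - 1) • χ₀ = 0 := by rw [sub_smul, one_smul, ← hs, h, sub_self]
        exact sub_eq_zero.1 ((smul_eq_zero.1 h2).resolve_right hχ₀.2.1)
      · right
        have h2 : (s - (-1)) • χ₀ = 0 := by rw [sub_smul, neg_one_smul, ← hs, h, sub_self]
        exact sub_eq_zero.1 ((smul_eq_zero.1 h2).resolve_right hχ₀.2.1)
    rcases hpm with rfl | rfl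
    · exact star_one ℂ
    · rw [star_neg, star_one]
  -- the momentum block
  set U0 := (fockTranslate (Pi.single 0 1 : TorusSite 2 L)).val with hU0
  set U1 := (fockTranslate (Pi.single 1 1 : TorusSite 2 L)).val with hU1
  set V : Submodule ℂ (Fock (Orb (FermionTorus 2 L))) :=
    Module.End.eigenspace (Matrix.toLin' U0) s₀ ⊓ Module.End.eigenspace (Matrix.toLin' U1) s₁ with hV
  have hmemV : ∀ χ, χ ∈ V ↔ U0 *ᵥ χ = s₀ • χ ∧ U1 *ᵥ χ = s₁ • χ := fun χ => by
    simp only [hV, Submodule.mem_inf, Module.End.mem_eigenspace_iff, Matrix.toLin'_apply]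
  -- `V` is invariant under every `H_L(U,φ)` (translation invariance) …
  have hVH : ∀ (φ : Fin 2 → ℝ) (χ : Fock (Orb (FermionTorus 2 L))), χ ∈ V →
      spinTwistedHubbardTorus L U φ *ᵥ χ ∈ V := by
    intro φ χ hχ
    rw [hmemV] at hχ ⊢
    constructor
    · rw [mulVec_mulVec, (fockTranslate_commute_spinTwistedHubbardTorus L _ U φ).eq, ← mulVec_mulVec,
        hχ.1, mulVec_smul]
    · rw [mulVec_mulVec, (fockTranslate_commute_spinTwistedHubbardTorus L _ U φ).eq, ← mulVec_mulVec,
        hχ.2, mulVec_smul]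
  -- … and under the antiunitary `T = F ∘ K` (`U_v` real, commuting with `F`; `s_i` real)
  have hFU : ∀ v : TorusSite 2 L,
      (fockRelabel (Orb.spinSwap : Orb (FermionTorus 2 L) ≃ Orb (FermionTorus 2 L))).val * (fockTranslate v).val =
      (fockTranslate v).val * (fockRelabel (Orb.spinSwap : Orb (FermionTorus 2 L) ≃ Orb (FermionTorus 2 L))).val :=
    fun v => by
      have h : fockRelabel (Orb.spinSwap : Orb (FermionTorus 2 L) ≃ Orb (FermionTorus 2 L)) * fockTranslate v =
          fockTranslate v * fockRelabel (Orb.spinSwap : Orb (FermionTorus 2 L) ≃ Orb (FermionTorus 2 L)) := by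
        rw [fockTranslate, ← map_mul, spinSwap_mul_translate, map_mul]
      exact congrArg Subtype.val h
  have hVT : ∀ χ ∈ V, (fockRelabel (Orb.spinSwap : Orb (FermionTorus 2 L) ≃ Orb (FermionTorus 2 L))).val *ᵥ
      star χ ∈ V := by
    intro χ hχ
    rw [hmemV] at hχ ⊢
    constructor
    · rw [hU0, mulVec_mulVec, ← hFU, ← mulVec_mulVec, ← star_fockRelabel_mulVec,
        show (fockRelabel (Orb.translate (Pi.single 0 1 : TorusSite 2 L))).val *ᵥ χ = s₀ • χ from hχ.1,
        star_smul, hsreal hs₀, mulVec_smul]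
    · rw [hU1, mulVec_mulVec, ← hFU, ← mulVec_mulVec, ← star_fockRelabel_mulVec,
        show (fockRelabel (Orb.translate (Pi.single 1 1 : TorusSite 2 L))).val *ᵥ χ = s₁ • χ from hχ.2,
        star_smul, hsreal hs₁, mulVec_smul]
  -- a ground state exists at `p` (clause (I): the quartet point is degenerate)
  have hpcell : p 0 ∈ Set.Ioc (-Real.pi) Real.pi ∧ p 1 ∈ Set.Ioc (-Real.pi) Real.pi := by
    have a0 := abs_lt.1 (show |p 0| < Real.pi by rw [hp0]; exact hcπ)
    have a1 := abs_lt.1 (show |p 1| < Real.pi by rw [hp1]; exact hcπ)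
    exact ⟨⟨a0.1, a0.2.le⟩, ⟨a1.1, a1.2.le⟩⟩
  have hexp : ∃ χ, IsGroundStateInSector (spinTwistedHubbardTorus L U p) N 0 χ := by
    obtain ⟨ψ₁, -, h₁, -, -⟩ := (hI p hpcell.1 hpcell.2).2 ⟨hp0, hp1⟩
    exact ⟨ψ₁, h₁⟩
  -- off `p` the disk is in the open cell and off the quartet: uniqueness and membership in `V`
  have hgeo := fun (φ : Fin 2 → ℝ) (hφ : (φ 0 - p 0) ^ 2 + (φ 1 - p 1) ^ 2 ≤ r ^ 2) =>
    disk_about_quartet_point hc0 hp0 hp1 hr.le hrc hrπ hφ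
  have huniq : ∀ φ : Fin 2 → ℝ, (φ 0 - p 0) ^ 2 + (φ 1 - p 1) ^ 2 ≤ r ^ 2 → φ ≠ p →
      ∀ χ₁ χ₂ : Fock (Orb (FermionTorus 2 L)),
      IsGroundStateInSector (spinTwistedHubbardTorus L U φ) N 0 χ₁ →
      IsGroundStateInSector (spinTwistedHubbardTorus L U φ) N 0 χ₂ → ∃ z : ℂ, χ₂ = z • χ₁ := by
    intro φ hφ hne χ₁ χ₂ h₁ h₂
    obtain ⟨g0, g1, goff⟩ := hgeo φ hφ
    have a0 := abs_lt.1 g0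
    have a1 := abs_lt.1 g1
    refine unique_of_no_orthogonal_pair (fun hpair => goff hne ?_) χ₁ χ₂ h₁ h₂
    exact (hI φ ⟨a0.1, a0.2.le⟩ ⟨a1.1, a1.2.le⟩).1 hpair
  have hinV : ∀ φ : Fin 2 → ℝ, (φ 0 - p 0) ^ 2 + (φ 1 - p 1) ^ 2 ≤ r ^ 2 → φ ≠ p →
      ∀ χ, IsGroundStateInSector (spinTwistedHubbardTorus L U φ) N 0 χ → χ ∈ V := by
    intro φ hφ hne χ hχ
    obtain ⟨g0, g1, goff⟩ := hgeo φ hφ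
    have hu : ∀ χ', IsGroundStateInSector (spinTwistedHubbardTorus L U φ) N 0 χ' → ∃ z : ℂ, χ' = z • χ :=
      fun χ' h' => huniq φ hφ hne χ χ' hχ h'
    obtain ⟨a, ha⟩ := exists_fockTranslate_mulVec_eq_smul L hχ hu (Pi.single 0 1)
    obtain ⟨b, hb⟩ := exists_fockTranslate_mulVec_eq_smul L hχ hu (Pi.single 1 1)
    have ha' : a = s₀ :=
      clauseI_translation_sign_eq_untwisted L hI hc0 hcπ g0 g1 (goff hne) (Pi.single 0 1) hχ₀ hχ hs₀ ha
    have hb' : b = s₁ :=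
      clauseI_translation_sign_eq_untwisted L hI hc0 hcπ g0 g1 (goff hne) (Pi.single 1 1) hχ₀ hχ hs₁ hb
    rw [hmemV]
    exact ⟨ha' ▸ ha, hb' ▸ hb⟩
  obtain ⟨χ₁, χ₂, h₁, h₂, horth, hV₁, hV₂⟩ :=
    exists_orthogonal_pair_in_block L U N V hVH hVT p hr hexp huniq hinV hHOL
  rw [hmemV] at hV₁ hV₂
  exact ⟨χ₁, χ₂, h₁, h₂, horth, hV₁.1, hV₁.2, hV₂.1, hV₂.2⟩

/-- **Registered sub-goal `stub_diracPairInMomentumBlock` of crux stmt-HubbardSuperconductivity-10395**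
(lead c11, line `birth`; structural input to stub C): the statement of
`dirac_pair_in_momentum_block` with all binders explicit and all names fully qualified.
Hatsugai (2006); Fukui–Hatsugai–Suzuki (2005). [folklore] -/
theorem stub_diracPairInMomentumBlock : ∀ (L : ℕ) [NeZero L] (U : ℝ) (N : ℕ) (c : ℝ), (∀ φ : Fin 2 → ℝ, φ 0 ∈ Set.Ioc (-Real.pi) Real.pi → φ 1 ∈ Set.Ioc (-Real.pi) Real.pi → ((∃ ψ₁ ψ₂ : Literature.MathematicalPhysics.QuantumLattice.Fock (Literature.MathematicalPhysics.QuantumLattice.Orb (Literature.MathematicalPhysics.QuantumLattice.FermionTorus 2 L)), Literature.MathematicalPhysics.QuantumLattice.IsGroundStateInSector (Literature.MathematicalPhysics.QuantumLattice.spinTwistedHubbardTorus L U φ) N 0 ψ₁ ∧ Literature.MathematicalPhysics.QuantumLattice.IsGroundStateInSector (Literature.MathematicalPhysics.QuantumLattice.spinTwistedHubbardTorus L U φ) N 0 ψ₂ ∧ star ψ₁ ⬝ᵥ ψ₂ = 0) ↔ (|φ 0| = c ∧ |φ 1| = c))) → 0 < c → c < Real.pi → ∀ (p : Fin 2 → ℝ),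 |p 0| = c → |p 1| = c → ∀ (r : ℝ), 0 < r → r < c → r < Real.pi - c → (∃ n₀ : ℕ, ∀ n ≥ n₀, ∀ ψ : Fin n → Literature.MathematicalPhysics.QuantumLattice.Fock (Literature.MathematicalPhysics.QuantumLattice.Orb (Literature.MathematicalPhysics.QuantumLattice.FermionTorus 2 L)), (∀ i : Fin n, Literature.MathematicalPhysics.QuantumLattice.IsGroundStateInSector (Literature.MathematicalPhysics.QuantumLattice.spinTwistedHubbardTorus L U (fun ν : Fin 2 => p ν + r * (if ν = 0 then Real.cos (2 * Real.pi * (i : ℕ) / n) else Real.sin (2 * Real.pi * (i : ℕ) / n)))) N 0 (ψ i) ∧ star (ψ i) ⬝ᵥ ψ i = 1) → (∏ i : Fin n, star (ψ i) ⬝ᵥ ψ (finRotate n i)).re < 0) → ∀ (χ₀ : Literature.MathematicalPhysics.QuantumLattice.Fock (Literature.MathematicalPhysics.QuantumLattice.Orb (Literature.MathematicalPhysics.QuantumLattice.FermionTorus 2 L))), Literature.MathematicalPhysics.QuantumLattice.IsGroundStateInSector (Literature.MathematicalPhysics.QuantumLattice.spinTwistedHubbardTorus L U 0) N 0 χ₀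 → ∀ (s₀ s₁ : ℂ), Matrix.mulVec (Literature.MathematicalPhysics.QuantumLattice.fockTranslate (Pi.single 0 1 : Literature.Probability.LatticeModels.TorusSite 2 L)).val χ₀ = s₀ • χ₀ → Matrix.mulVec (Literature.MathematicalPhysics.QuantumLattice.fockTranslate (Pi.single 1 1 : Literature.Probability.LatticeModels.TorusSite 2 L)).val χ₀ = s₁ • χ₀ → ∃ χ₁ χ₂ : Literature.MathematicalPhysics.QuantumLattice.Fock (Literature.MathematicalPhysics.QuantumLattice.Orb (Literature.MathematicalPhysics.QuantumLattice.FermionTorus 2 L)), Literature.MathematicalPhysics.QuantumLattice.IsGroundStateInSector (Literature.MathematicalPhysics.QuantumLattice.spinTwistedHubbardTorus L U p) N 0 χ₁ ∧ Literature.MathematicalPhysics.QuantumLattice.IsGroundStateInSector (Literature.MathematicalPhysics.QuantumLattice.spinTwistedHubbardTorus L U p) N 0 χ₂ ∧ star χ₁ ⬝ᵥ χ₂ = 0 ∧ Matrix.mulVec (Literature.MathematicalPhysics.QuantumLattice.fockTranslate (Pi.single 0 1 : Literature.Probability.LatticeModels.TorusSite 2 L)).val χ₁ = s₀ • χ₁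 ∧ Matrix.mulVec (Literature.MathematicalPhysics.QuantumLattice.fockTranslate (Pi.single 1 1 : Literature.Probability.LatticeModels.TorusSite 2 L)).val χ₁ = s₁ • χ₁ ∧ Matrix.mulVec (Literature.MathematicalPhysics.QuantumLattice.fockTranslate (Pi.single 0 1 : Literature.Probability.LatticeModels.TorusSite 2 L)).val χ₂ = s₀ • χ₂ ∧ Matrix.mulVec (Literature.MathematicalPhysics.QuantumLattice.fockTranslate (Pi.single 1 1 : Literature.Probability.LatticeModels.TorusSite 2 L)).val χ₂ = s₁ • χ₂ :=
  fun L _ _ _ _ hI hc0 hcπ _ hp0 hp1 _ hr hrc hrπ hHOL _ hχ₀ _ _ hs₀ hs₁ =>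
    dirac_pair_in_momentum_block L hI hc0 hcπ hp0 hp1 hr hrc hrπ hHOL hχ₀ hs₀ hs₁

end Summit.HubbardSuperconductivity.HubbardSuperconductivity.Theorems.NodalDiracTwist.BridgeNodalToDWave

end
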